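import Summits.Ventures.QEC.CircuitDistance.PortLeafWF
import Summits.Ventures.DiscreteObjects.UnitDistance.KernelRupCheck
import HarnessLib

/-!
# P3-PORT (D2c): a KERNEL-CHEAP well-formedness check `Leaf.wfFast` for large leaves (cell `qec`, experiment CDX, seat qec-cdx-type-1)

`Leaf.wf` / `Leaf.wf₂` recompute every detector row `detRow d = {c < n : d ∈ coords[c]}` by scanning all coordinates
(`|detectors| · n` list-walking steps, each an `O(c)` `getD` — hours / out of memory in the kernel for the 777-coordinate
budget-1 leaves of `[[144,12,12]]`).  `Leaf.wfFast` never recomputes a detector row.  It reads the CNF rows as the CLAIMED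
table (row `d` = the detector row of detector `d`, for `d < D := |rows| − (k − 1)`; then the `k − 1` link rows in order) and
verifies the claim by two incidence passes through binary tries (the tree's `KRup.Store`, entries `key :: value`, the key
re-checked at every lookup so that only the store's `All`-invariant is used, never its indexing):
(i) every `c` of row `d` has `c < n` and `d ∈ coords[c]`; (ii) every `d ∈ coords[c]` (`c < n`) has `d < D` and `c ∈ row d`;
rows strictly increasing and non-empty; group/null coordinates strictly increasing and `< n`.  **`Leaf.wf_of_wfFast`**
recovers `L.wf = true`, so every leaf lemma (`Leaf.not_realised_of_unsat`, `…_of_nullSplit`) applies unchanged.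
-/

namespace Summit.Ventures.QEC.CircuitDistance.Fibre

open Summit.Ventures.DiscreteObjects.UnitDistance (KRup.Store)
open Summit.Ventures.DiscreteObjects.UnitDistance.KRup

/-! ## Small Bool helpers -/

/-- Strictly increasing list of naturals. -/
def incr : List ℕ → Bool
  | a :: b :: t => decide (a < b) && incr (b :: t)
  | _ => true

/-- A strictly increasing list is pairwise `<`. -/
theorem incr_pairwise : ∀ l : List ℕ, incr l = true → l.Pairwise (· < ·)
  | [], _ => List.Pairwise.nil
  | [a], _ => List.pairwise_singleton _ _
  | a :: b :: t, h => by
    unfold incr at h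
    rw [Bool.and_eq_true, decide_eq_true_eq] at h
    have ht := incr_pairwise (b :: t) h.2
    refine List.Pairwise.cons ?_ ht
    intro x hx
    rcases List.mem_cons.1 hx with rfl | hx
    · exact h.1
    · exact lt_trans h.1 (List.rel_of_pairwise_cons ht hx)

/-- A strictly increasing list has no duplicates. -/
theorem nodup_of_incr {l : List ℕ} (h : incr l = true) : l.Nodup :=
  (incr_pairwise l h).imp fun hab => Nat.ne_of_lt hab

/-- Binary-digit fuel: `bitsFuel f m ≥` number of binary digits of `m` (for `f` large). -/
def bitsFuel : ℕ → ℕ → ℕ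
  | 0, _ => 0
  | f + 1, m => if m = 0 then 0 else bitsFuel f (m / 2) + 1

/-- `key :: value` entries of a list of lists, keys = positions. -/
def keyed (l : List (List ℕ)) : List (List ℕ) := l.zipIdx.map fun p => p.2 :: p.1

/-- Does the fetched entry carry key `key` and contain `x`? -/
def entryHas : Option (List ℕ) → ℕ → ℕ → Bool
  | some (k :: v), key, x => (k == key) && v.elem x
  | _, _, _ => false

/-- Trie lookup with key re-check: the entry stored under id `key + 1` has key `key` and contains `x`. -/
def storeHas (S : Store) (key x : ℕ) : Bool := entryHas (S.get (key + 1)) key x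

/-! ## The fast check -/

/-- KERNEL-CHEAP WELL-FORMEDNESS (implies `Leaf.wf`, see `wf_of_wfFast`). -/
def Leaf.wfFast (L : Leaf) : Bool :=
  let D := L.rows.length - (L.k - 1)
  let dp := bitsFuel 64 (L.n + L.rows.length + 2)
  let SC := Store.ofList dp (keyed L.coords)
  let SR := Store.ofList dp (keyed (L.rows.take D))
  let gl := L.groups.flatten ++ L.nulls
  decide (0 < L.k) && decide (L.k ≤ L.w) && decide (L.us = [L.group 0]) &&
  incr gl && (gl.all fun c => decide (c < L.n)) &&
  decide (D + (L.k - 1) = L.rows.length) &&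
  ((L.rows.take D).zipIdx.all fun p =>
    !p.1.isEmpty && incr p.1 && p.1.all fun c => decide (c < L.n) && storeHas SC c p.2) &&
  (L.coords.zipIdx.all fun p => decide (L.n ≤ p.2) || p.1.all fun d => decide (d < D) && storeHas SR d p.2) &&
  decide (L.rows.drop D = L.linkRows)

/-! ## Soundness -/

/-- What a fetched-and-key-checked entry tells. -/
theorem entryHas_true {o : Option (List ℕ)} {key x : ℕ} (h : entryHas o key x = true) :
    ∃ v, o = some (key :: v) ∧ x ∈ v := by
  match o, h with
  | some (k :: v), h =>
    unfold entryHas at h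
    rw [Bool.and_eq_true] at h
    have hk : k = key := by simpa using h.1
    exact ⟨v, by rw [hk], List.mem_of_elem_eq_true h.2⟩
  | none, h => exact absurd h (by simp [entryHas])
  | some [], h => exact absurd h (by simp [entryHas])

/-- Entries of `keyed l` are `i :: l[i]`. -/
theorem keyed_all (l : List (List ℕ)) :
    ∀ C ∈ keyed l, ∃ v i, C = i :: v ∧ l[i]? = some v := by
  intro C hC
  unfold keyed at hC
  obtain ⟨p, hp, rfl⟩ := List.mem_map.1 hC
  exact ⟨p.1, p.2, rfl, List.mem_zipIdx_iff_getElem?.1 hp⟩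

/-- A successful key-checked lookup in the trie of `keyed l` certifies `x ∈ l[key]`. -/
theorem storeHas_sound {dp : ℕ} {l : List (List ℕ)} {key x : ℕ}
    (h : storeHas (Store.ofList dp (keyed l)) key x = true) : ∃ v, l[key]? = some v ∧ x ∈ v := by
  unfold storeHas at h
  obtain ⟨v, hget, hx⟩ := entryHas_true h
  have hall := Store.All.ofList (P := fun C => ∃ v i, C = i :: v ∧ l[i]? = some v) dp (keyed_all l)
  obtain ⟨v', i, hC, hi⟩ := Store.All.get hall hget
  obtain ⟨rfl, rfl⟩ := List.cons.inj hC
  exact ⟨v, hi, hx⟩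

/-- **`wfFast` implies `wf`.** -/
theorem Leaf.wf_of_wfFast (L : Leaf) (h : L.wfFast = true) : L.wf = true := by
  unfold Leaf.wfFast at h
  simp only [Bool.and_eq_true, decide_eq_true_eq, List.all_eq_true, Bool.or_eq_true,
    Bool.not_eq_true', List.isEmpty_eq_false_iff] at h
  obtain ⟨⟨⟨⟨⟨⟨⟨⟨h0, hkw⟩, hus⟩, hincr⟩, hlt⟩, hD⟩, hrowsT⟩, hcoords⟩, hlinks⟩ := h
  set D := L.rows.length - (L.k - 1) with hDdef
  set dp := bitsFuel 64 (L.n + L.rows.length + 2) with hdp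
  unfold Leaf.wf
  simp only [Bool.and_eq_true, decide_eq_true_eq, List.all_eq_true, List.any_eq_true]
  refine ⟨⟨⟨⟨⟨h0, fun c hc => hlt c hc⟩, nodup_of_incr hincr⟩, fun r hr => ?_⟩, hus⟩, hkw⟩
  -- the row `r` is a detector row (index `< D`) or a link row
  rw [← List.take_append_drop D L.rows, List.mem_append] at hr
  rcases hr with hr | hr
  · -- detector row number `d`
    obtain ⟨d, hd⟩ := List.mem_iff_getElem?.1 hr
    have hT := hrowsT (r, d) (List.mem_zipIdx_iff_getElem?.2 hd)
    obtain ⟨⟨hne, hrincr⟩, hcells⟩ := hT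
    -- members of `r` versus members of `detRow d`
    have hsub : ∀ c ∈ r, c ∈ L.detRow d := by
      intro c hc
      obtain ⟨hcn, hS⟩ := hcells c hc
      obtain ⟨v, hv, hdv⟩ := storeHas_sound hS
      unfold Leaf.detRow Leaf.coordsOf
      rw [List.mem_filter, List.mem_range, List.getD_eq_getElem?_getD, hv, Option.getD_some, decide_eq_true_eq]
      exact ⟨hcn, hdv⟩
    have hsup : ∀ c ∈ L.detRow d, c ∈ r := by
      intro c hc
      unfold Leaf.detRow Leaf.coordsOf at hc
      rw [List.mem_filter, List.mem_range, decide_eq_true_eq, List.getD_eq_getElem?_getD] at hc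
      obtain ⟨hcn, hdc⟩ := hc
      rcases hv : L.coords[c]? with _ | cs
      · rw [hv, Option.getD_none] at hdc; exact absurd hdc List.not_mem_nil
      · rw [hv, Option.getD_some] at hdc
        have hC := hcoords (cs, c) (List.mem_zipIdx_iff_getElem?.2 hv)
        rcases hC with hC | hC
        · exact absurd hcn (not_lt.2 hC)
        · obtain ⟨-, hS⟩ := hC d hdc
          obtain ⟨v, hv', hcv⟩ := storeHas_sound hS
          rw [hd] at hv'
          cases hv'
          exact hcv
    have hperm : r.Perm (L.detRow d) := by
      rw [List.perm_ext_iff_of_nodup (nodup_of_incr hrincr)]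
      · exact fun c => ⟨hsub c, hsup c⟩
      · unfold Leaf.detRow; exact List.nodup_range.filter _
    -- `d` is a detector of the leaf (its row is non-empty)
    have hdet : d ∈ L.detectors := by
      obtain ⟨c, hc⟩ := List.exists_mem_of_ne_nil r hne
      obtain ⟨-, hS⟩ := hcells c hc
      obtain ⟨v, hv, hdv⟩ := storeHas_sound hS
      unfold Leaf.detectors
      rw [List.mem_dedup, List.mem_flatten]
      exact ⟨v, List.mem_of_getElem? hv, hdv⟩
    refine ⟨L.detRow d, ?_, hperm⟩
    unfold Leaf.admissible
    exact List.mem_append_left _ (List.mem_map.2 ⟨d, hdet, rfl⟩)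
  · -- link row
    rw [hlinks] at hr
    refine ⟨r, ?_, List.Perm.refl r⟩
    unfold Leaf.admissible
    unfold Leaf.linkRows at hr
    exact List.mem_append_right _ hr

end Summit.Ventures.QEC.CircuitDistance.Fibre
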